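import Mathlib
import Literature.Analysis.FluidPDE.ClassicalSolution
import Literature.Analysis.FluidPDE.LerayHopf
import Literature.Analysis.FluidPDE.LerayHopfProofs
import Literature.Analysis.FluidPDE.NSVorticity
import Literature.Analysis.FluidPDE.TaoLocalisation
import Literature.Analysis.FluidPDE.TaoLocalisationHolds
import Literature.Analysis.FluidPDE.TaoLocalisationProofs
import Literature.Analysis.FluidPDE.TaoEnstrophyLocalisation
import Literature.Analysis.FluidPDE.AxisymmetricNoSwirlWeightedEnstrophyProofs
import Summits.NavierStokesRegularity.NavierStokesRegularity.Theorems.PlaneEnergyCeilingPlanarEnergyAPrioriClosedSlab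
import Summits.NavierStokesRegularity.NavierStokesRegularity.Theses.L3TimeExponentPincer
import Summits.NavierStokesRegularity.NavierStokesRegularity.Theorems.L3TimeExponentPincerEffNode
import HarnessLib.Audit
import HarnessLib

/-!
# Smooth-branch collapse of line `EffSat` (crux `L3CascadeJaw`, route `L3TimeExponentPincer`)

Support file for `stmt-NavierStokesRegularity-19499` (cell ns-regularity-ideate, seat p2, ROUND-7; source of record
`run/shared/lean/pub/ns-regularity-ideate/ns-regularity-ideate-p2/SmoothBranch.lean`).  Below a regular time the frame
solution is uniformly bounded and uniformly Lipschitz on `[0,T)` (Tao 2013 on the closed slab, tree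
`tao2011_hasBoundedSobolevNormsOn_holds`), whence

* `jawSmoothBranch_holds : JawSmoothBranch` — the registered stub `stub_jawSmoothBranch` of `Lines/effsat.lean`, verbatim;
* `effSaturatesAt_one_of_hasSmoothExtensionPast` — `K₃(1)` on the smooth branch (`m = (4π/3)B²T²`, `R₀ = 1`, `L = 2B(2E₀+1)T`);
* `effScaleSaturation_one_iff_blowupBranch`, `l3CascadeJaw_iff_blowupBranch` — node and crux live on the blow-up branch;
* `l3CascadeJaw_of_effSatBlowup : EffSatBlowup → …Theses.L3TimeExponentPincer.L3CascadeJaw` — the ONE-STUB composition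
  (route decl by name; conditional on the open stub `stub_effSaturation_blowup`).

0 `sorry`.
-/

noncomputable section

namespace Summit.NavierStokesRegularity.NavierStokesRegularity.Theorems.L3TimeExponentPincerSmoothBranch

open MeasureTheory Set Filter Metric Function Topology
open scoped ENNReal NNReal Topology
open Literature.Analysis.FluidPDE
open Summit.NavierStokesRegularity.NavierStokesRegularity.Theorems.L3TimeExponentPincerEffNode

/-! ## §1  The statement of stub (M) of line `EffSat`, VERBATIM -/

/-- VERBATIM the statement of `stub_jawSmoothBranch` (`route/LineEffSat.lean`): the jaw on the
smooth-past-`T` branch. -/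
def JawSmoothBranch : Prop :=
  ∀ q : ℝ, 4 < q → q < 5 → ∀ (ν T : ℝ), 0 < ν → 0 < T → ∀ (u : ℝ → (EuclideanSpace ℝ (Fin 3)) → (EuclideanSpace ℝ (Fin 3))) (p : ℝ → (EuclideanSpace ℝ (Fin 3)) → ℝ),
    IsClassicalNSSolutionOn (Ico 0 T) ν 0 u p → IsLerayHopfOn T ν 0 (u 0) u →
    HasRapidSpatialDecay (u 0) → HasSmoothExtensionPast ν 0 u T →
    ∃ T₂ ∈ Ioo 0 T, (∫⁻ t in Ioo T₂ T, eLpNorm (u t) 3 volume ^ q) < ⊤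

/-! ## §2  Below a regular time: uniform sup / Lipschitz bounds (Tao 2013 on the closed slab) and the jaw -/

/-- `‖v‖₃³ = ∫ |v|³` (as a real power of the `L³` seminorm). -/
theorem eLpNorm_three_rpow_three_eq (v : (EuclideanSpace ℝ (Fin 3)) → (EuclideanSpace ℝ (Fin 3))) :
    eLpNorm v 3 volume ^ (3 : ℝ) = ∫⁻ x, ‖v x‖ₑ ^ (3 : ℝ) := by
  rw [eLpNorm_eq_lintegral_rpow_enorm_toReal (by norm_num) ENNReal.ofNat_ne_top,
    ENNReal.toReal_ofNat, ← ENNReal.rpow_mul]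
  norm_num

/-- `‖v‖₃³ ≤ a · ∫|v|²` under a pointwise bound `|v| ≤ a`. -/
theorem eLpNorm_three_rpow_three_le_of_forall_le {v : (EuclideanSpace ℝ (Fin 3)) → (EuclideanSpace ℝ (Fin 3))} {a : ℝ} (hv : ∀ x, ‖v x‖ ≤ a) :
    eLpNorm v 3 volume ^ (3 : ℝ) ≤ ENNReal.ofReal a * ∫⁻ x, ‖v x‖ₑ ^ 2 := by
  rw [eLpNorm_three_rpow_three_eq]
  calc ∫⁻ x, ‖v x‖ₑ ^ (3 : ℝ) = ∫⁻ x, ‖v x‖ₑ * ‖v x‖ₑ ^ 2 := by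
        refine lintegral_congr fun x => ?_
        rw [show (3 : ℝ) = ((3 : ℕ) : ℝ) by norm_num, ENNReal.rpow_natCast]
        ring
    _ ≤ ∫⁻ x, ENNReal.ofReal a * ‖v x‖ₑ ^ 2 := by
        refine lintegral_mono fun x => ?_
        have hx : ‖v x‖ₑ ≤ ENNReal.ofReal a := by
          rw [← ofReal_norm]; exact ENNReal.ofReal_le_ofReal (hv x)
        exact mul_le_mul' hx le_rfl
    _ = ENNReal.ofReal a * ∫⁻ x, ‖v x‖ₑ ^ 2 := lintegral_const_mul' _ _ ENNReal.ofReal_ne_top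

/-- **A point carrying the `L³`-mass.**  If `∫|v|² ≤ Kr` and `a · Kr < ‖v‖₃³` (as a real number; so
`‖v‖₃³ < ∞`), then `a ≤ |v(x)|` at some point `x` (else `‖v‖₃³ ≤ a ∫|v|² ≤ a Kr`). -/
theorem exists_le_norm_of_l3 {v : (EuclideanSpace ℝ (Fin 3)) → (EuclideanSpace ℝ (Fin 3))} {Kr a : ℝ} (hKr : 0 ≤ Kr)
    (hE : ∫⁻ x, ‖v x‖ₑ ^ 2 ≤ ENNReal.ofReal Kr)
    (ha : a * Kr < (eLpNorm v 3 volume ^ (3 : ℝ)).toReal) : ∃ x, a ≤ ‖v x‖ := by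
  by_contra hcon
  push Not at hcon
  have ha0 : 0 ≤ a := (norm_nonneg (v 0)).trans (hcon 0).le
  have hle : eLpNorm v 3 volume ^ (3 : ℝ) ≤ ENNReal.ofReal (a * Kr) := by
    calc eLpNorm v 3 volume ^ (3 : ℝ) ≤ ENNReal.ofReal a * ∫⁻ x, ‖v x‖ₑ ^ 2 :=
          eLpNorm_three_rpow_three_le_of_forall_le fun x => (hcon x).le
      _ ≤ ENNReal.ofReal a * ENNReal.ofReal Kr := by gcongr
      _ = ENNReal.ofReal (a * Kr) := by rw [ENNReal.ofReal_mul ha0]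
  have hle' := ENNReal.toReal_mono ENNReal.ofReal_ne_top hle
  rw [ENNReal.toReal_ofReal (mul_nonneg ha0 hKr)] at hle'
  exact absurd ha (not_lt.2 hle')

/-- **Uniform sup and Lipschitz bounds on `[0,T)` below a regular time.**  If `u` is Leray–Hopf on `[0,T)`
from the rapidly decaying `u 0` and extends classically past `T`, there is ONE `B > 0` with `|u(t,x)| ≤ B`
and `|u(t,x) - u(t,y)| ≤ B |x - y|` for all `t ∈ [0,T)`, `x, y`.  Proof (template:
`exists_lipschitz_curl_of_hasSmoothExtensionPast`): the extension is classical on the CLOSED slab `[0,T]`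
with energy `≤ 2E(u 0)` (Fatou at `t = T`) and datum `u 0`, so Tao 2013 bounds all its Sobolev norms there
(`tao2011_hasBoundedSobolevNormsOn_holds`); `H² ⊂ C_B` applied to `u'` and to `Du'` bounds both, and the
mean-value inequality turns the gradient bound into a Lipschitz bound.
[cite: Tao2011, Cor. 11.1 + Cor. 4.3 + Thm. 5.4 (iv); AdamsFournier2003, Thm. 4.12] -/
theorem uniform_bounds_of_hasSmoothExtensionPast {ν T : ℝ} (hν : 0 < ν) (hT : 0 < T)
    {u : ℝ → (EuclideanSpace ℝ (Fin 3)) → (EuclideanSpace ℝ (Fin 3))} (hLH : IsLerayHopfOn T ν 0 (u 0) u) (hdec : HasRapidSpatialDecay (u 0))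
    (hext : HasSmoothExtensionPast ν 0 u T) :
    ∃ B : ℝ, 0 < B ∧ ∀ t ∈ Ico 0 T,
      (∀ x, ‖u t x‖ ≤ B) ∧ (∀ x y, ‖u t x - u t y‖ ≤ B * ‖x - y‖) := by
  obtain ⟨T', hT', u', p', hcl', hagree⟩ := hext
  -- the extension on the closed slab `[0,T]`
  have hsol : IsClassicalNSSolutionOn (Icc 0 T) ν 0 u' p' :=
    hcl'.mono (Icc_subset_Ico_right hT') (uniqueDiffOn_Icc hT)
  -- energy on `[0,T]`: Leray–Hopf below `T`, Fatou at `T`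
  set K : ℝ≥0∞ := ENNReal.ofReal (2 * VectorCalculus.kineticEnergy (u 0)) with hK
  have hE₀ : ∀ t ∈ Ico 0 T, ∫⁻ x, ‖u' t x‖ₑ ^ 2 ≤ K := fun t ht => by
    rw [hagree t ht]
    exact hLH.lintegral_enorm_sq_le hν.le ⟨ht.1, ht.2.le⟩
  have hET : ∫⁻ x, ‖u' T x‖ₑ ^ 2 ≤ K :=
    Summit.NavierStokesRegularity.NavierStokesRegularity.Theorems.PlanarEnergyAPriori.lintegral_enorm_sq_le_of_extension
      hcl'.smooth_velocity hT hT' hE₀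
  have hE : ∃ C : ℝ≥0, ∀ t ∈ Icc 0 T, ∫⁻ x, ‖u' t x‖ₑ ^ 2 ≤ C := by
    refine ⟨(2 * VectorCalculus.kineticEnergy (u 0)).toNNReal, fun t ht => ?_⟩
    rcases ht.2.eq_or_lt with h | h
    · rw [h]; exact hET
    · exact hE₀ t ⟨ht.1, h⟩
  have hdec' : HasRapidSpatialDecay (u' 0) := by
    rw [hagree 0 ⟨le_rfl, hT⟩]
    exact hdec
  -- Tao: bounded Sobolev norms on `[0,T]`
  have hH : HasBoundedSobolevNormsOn (Icc 0 T) u' :=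
    tao2011_hasBoundedSobolevNormsOn_holds hν hT hsol hE hdec'
  -- Sobolev imbedding applied to `u'` …
  have hC2 : ∀ t ∈ Icc 0 T, ContDiff ℝ 2 (u' t) := fun t ht =>
    (hsol.contDiff_velocity ht).of_le (by norm_cast)
  obtain ⟨B₀, hB₀⟩ := linfty_bound_of_hasBoundedSobolevNormsOn_holds hC2 hH
  -- … and to the gradient `Du'`
  set g : ℝ → (EuclideanSpace ℝ (Fin 3)) → ((EuclideanSpace ℝ (Fin 3)) →L[ℝ] (EuclideanSpace ℝ (Fin 3))) := fun t => fderiv ℝ (u' t) with hg_def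
  have hg : ∀ t ∈ Icc 0 T, ContDiff ℝ 2 (g t) := by
    intro t ht
    have hu : ContDiff ℝ 3 (u' t) := (hsol.contDiff_velocity ht).of_le (by norm_cast)
    exact hu.fderiv_right (m := 2) (by norm_num)
  have hHg : ∀ j < 3, ∃ C : ℝ≥0, ∀ t ∈ Icc 0 T,
      ∫⁻ x, ‖iteratedFDeriv ℝ j (g t) x‖ₑ ^ 2 ≤ C := by
    intro j _
    obtain ⟨C, hC⟩ := hH (j + 1)
    refine ⟨C, fun t ht => le_of_eq_of_le (lintegral_congr fun x => ?_) (hC t ht)⟩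
    rw [← ofReal_norm, hg_def, norm_iteratedFDeriv_fderiv, ofReal_norm]
  obtain ⟨B₁, hB₁0, hB₁⟩ := exists_forall_norm_le_of_sobolev_bounds (S := Icc 0 T) hg hHg
  have hBpos : 0 < max B₀ B₁ + 1 := by linarith [le_max_right B₀ B₁]
  refine ⟨max B₀ B₁ + 1, hBpos, fun t ht => ⟨fun x => ?_, fun x y => ?_⟩⟩
  · have ht' : t ∈ Icc 0 T := Ico_subset_Icc_self ht
    rw [← hagree t ht]
    calc ‖u' t x‖ ≤ B₀ := hB₀ t ht' x
      _ ≤ max B₀ B₁ + 1 := by linarith [le_max_left B₀ B₁]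
  · have ht' : t ∈ Icc 0 T := Ico_subset_Icc_self ht
    have hC1 : ContDiff ℝ 1 (u' t) := (hsol.contDiff_velocity ht').of_le (by norm_cast)
    have hdiff : Differentiable ℝ (u' t) := hC1.differentiable one_ne_zero
    have hlip : LipschitzWith B₁.toNNReal (u' t) := by
      refine lipschitzWith_of_nnnorm_fderiv_le hdiff fun z => ?_
      rw [← NNReal.coe_le_coe, coe_nnnorm, Real.coe_toNNReal B₁ hB₁0]
      exact hB₁ t ht' z
    have hD : ‖u' t x - u' t y‖ ≤ B₁ * ‖x - y‖ := by
      have h := hlip.dist_le_mul x y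
      rwa [dist_eq_norm, dist_eq_norm, Real.coe_toNNReal B₁ hB₁0] at h
    rw [← hagree t ht]
    calc ‖u' t x - u' t y‖ ≤ B₁ * ‖x - y‖ := hD
      _ ≤ (max B₀ B₁ + 1) * ‖x - y‖ := by
          apply mul_le_mul_of_nonneg_right _ (norm_nonneg _)
          linarith [le_max_right B₀ B₁]

/-- **Uniform `L³` bound below a regular time**: `‖u(t)‖₃³ ≤ B · 2E(u 0)` on `[0,T)`. -/
theorem eLpNorm_three_bounded_of_hasSmoothExtensionPast {ν T : ℝ} (hν : 0 < ν) (hT : 0 < T)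
    {u : ℝ → (EuclideanSpace ℝ (Fin 3)) → (EuclideanSpace ℝ (Fin 3))} (hLH : IsLerayHopfOn T ν 0 (u 0) u) (hdec : HasRapidSpatialDecay (u 0))
    (hext : HasSmoothExtensionPast ν 0 u T) :
    ∃ M : ℝ, 0 ≤ M ∧ ∀ t ∈ Ico 0 T, eLpNorm (u t) 3 volume ^ (3 : ℝ) ≤ ENNReal.ofReal M := by
  obtain ⟨B, hB, hbd⟩ := uniform_bounds_of_hasSmoothExtensionPast hν hT hLH hdec hext
  set Kr : ℝ := 2 * VectorCalculus.kineticEnergy (u 0) with hKr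
  have hKr0 : 0 ≤ Kr :=
    mul_nonneg zero_le_two (Literature.Analysis.FluidPDE.kineticEnergy_nonneg _)
  refine ⟨B * Kr, by positivity, fun t ht => ?_⟩
  calc eLpNorm (u t) 3 volume ^ (3 : ℝ) ≤ ENNReal.ofReal B * ∫⁻ x, ‖u t x‖ₑ ^ 2 :=
        eLpNorm_three_rpow_three_le_of_forall_le (hbd t ht).1
    _ ≤ ENNReal.ofReal B * ENNReal.ofReal Kr := by
        gcongr; exact hLH.lintegral_enorm_sq_le hν.le ⟨ht.1, ht.2.le⟩
    _ = ENNReal.ofReal (B * Kr) := by rw [ENNReal.ofReal_mul hB.le]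

/-- **T-6.3 (a): `stub_jawSmoothBranch` is a THEOREM.**  A frame solution that extends smoothly past `T`
has `∫_{T/2}^T ‖u(t)‖₃^q dt < ∞` for every `q ∈ (4,5)` (indeed for every `q ≥ 0`: `‖u(t)‖₃` is bounded on
`[0,T)`).  [cite: Tao2011, Cor. 11.1 + Cor. 4.3 + Thm. 5.4 (iv)] -/
theorem jawSmoothBranch_holds : JawSmoothBranch := by
  intro q hq4 _hq5 ν T hν hT u p _hcl hLH hdec hext
  obtain ⟨M, _hM, h3⟩ := eLpNorm_three_bounded_of_hasSmoothExtensionPast hν hT hLH hdec hext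
  have hq0 : 0 ≤ q := by linarith
  set C : ℝ≥0∞ := ENNReal.ofReal M ^ (1 / 3 : ℝ) with hC
  have hCq : C ^ q ≠ ⊤ :=
    ENNReal.rpow_ne_top_of_nonneg hq0 (ENNReal.rpow_ne_top_of_nonneg (by norm_num) ENNReal.ofReal_ne_top)
  have hpt : ∀ t ∈ Ico 0 T, eLpNorm (u t) 3 volume ^ q ≤ C ^ q := by
    intro t ht
    refine ENNReal.rpow_le_rpow ?_ hq0
    have hroot : eLpNorm (u t) 3 volume = (eLpNorm (u t) 3 volume ^ (3 : ℝ)) ^ (1 / 3 : ℝ) := by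
      rw [← ENNReal.rpow_mul]; norm_num
    rw [hroot, hC]
    exact ENNReal.rpow_le_rpow (h3 t ht) (by norm_num)
  refine ⟨T / 2, ⟨by linarith, by linarith⟩, ?_⟩
  calc (∫⁻ t in Ioo (T / 2) T, eLpNorm (u t) 3 volume ^ q)
      ≤ ∫⁻ _ in Ioo (T / 2) T, C ^ q :=
        lintegral_mono_ae ((ae_restrict_mem measurableSet_Ioo).mono fun t ht =>
          hpt t ⟨by linarith [ht.1], ht.2⟩)
    _ = C ^ q * volume (Ioo (T / 2) T) := setLIntegral_const _ _
    _ < ⊤ := ENNReal.mul_lt_top hCq.lt_top (by rw [Real.volume_Ioo]; exact ENNReal.ofReal_lt_top)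

/-! ## §3  T-6.3 (b): `K₃(1)` HOLDS on the smooth branch -/

/-- **`K₃(1)` below a regular time.**  If the frame solution extends smoothly past `T` then
`EffSaturatesAt 1 u T`, with the window `(0,T)`, `R₀ = 1`, `L = 2B(2E+1)T`, `m = (4π/3) B² T²`
(`B` = the uniform sup/Lipschitz bound of §2, `E = E(u 0)`): at time `t` put `N = ‖u(t)‖₃³`, `U = N/L`;
some point has `|u(t,x_t)| ≥ N/(2E+1) = 2BTU` (§2, `exists_le_norm_of_l3`), the `B`-Lipschitz bound keeps
`|u(t,·)| ≥ BTU` on `B(x_t, UT)`, a ball of radius `UT ≥ U(T-t)` = the causal scale of the effective speed,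
carrying energy `≥ (BTU)² · (4π/3)(UT)³ = m U² (UT)³`.  (`N = 0`: `U = 0` and all clauses are trivial.) -/
theorem effSaturatesAt_one_of_hasSmoothExtensionPast {ν T : ℝ} (hν : 0 < ν) (hT : 0 < T)
    {u : ℝ → (EuclideanSpace ℝ (Fin 3)) → (EuclideanSpace ℝ (Fin 3))} (hLH : IsLerayHopfOn T ν 0 (u 0) u) (hdec : HasRapidSpatialDecay (u 0))
    (hext : HasSmoothExtensionPast ν 0 u T) : EffSaturatesAt 1 u T := by
  obtain ⟨B, hB, hbd⟩ := uniform_bounds_of_hasSmoothExtensionPast hν hT hLH hdec hext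
  set Kr : ℝ := 2 * VectorCalculus.kineticEnergy (u 0) with hKr
  have hKr0 : 0 ≤ Kr :=
    mul_nonneg zero_le_two (Literature.Analysis.FluidPDE.kineticEnergy_nonneg _)
  have hK1 : 0 < Kr + 1 := by linarith
  have hLpos : 0 < 2 * B * (Kr + 1) * T := by positivity
  -- constants: m = (4π/3) B² T², R₀ = 1, L = 2B(Kr+1)T, window (0,T)
  refine ⟨Real.pi * 4 / 3 * B ^ 2 * T ^ 2, by positivity, 1, one_pos, 2 * B * (Kr + 1) * T, hLpos,
    0, hT, fun t ht => ?_⟩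
  have ht' : t ∈ Ico 0 T := ⟨ht.1.le, ht.2⟩
  have hTt : T - t ≤ T := by linarith [ht.1]
  have hE : ∫⁻ x, ‖u t x‖ₑ ^ 2 ≤ ENNReal.ofReal Kr :=
    hLH.lintegral_enorm_sq_le hν.le ⟨ht.1.le, ht.2.le⟩
  -- the `L³`-mass `N = ‖u(t)‖₃³` is finite
  have h3le : eLpNorm (u t) 3 volume ^ (3 : ℝ) ≤ ENNReal.ofReal (B * Kr) := by
    calc eLpNorm (u t) 3 volume ^ (3 : ℝ) ≤ ENNReal.ofReal B * ∫⁻ x, ‖u t x‖ₑ ^ 2 :=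
          eLpNorm_three_rpow_three_le_of_forall_le (hbd t ht').1
      _ ≤ ENNReal.ofReal B * ENNReal.ofReal Kr := by gcongr
      _ = ENNReal.ofReal (B * Kr) := by rw [ENNReal.ofReal_mul hB.le]
  have h3top : eLpNorm (u t) 3 volume ^ (3 : ℝ) ≠ ⊤ := ne_top_of_le_ne_top ENNReal.ofReal_ne_top h3le
  set N : ℝ := (eLpNorm (u t) 3 volume ^ (3 : ℝ)).toReal with hN
  have hN0 : 0 ≤ N := ENNReal.toReal_nonneg
  have hNeq : eLpNorm (u t) 3 volume ^ (3 : ℝ) = ENNReal.ofReal N :=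
    (ENNReal.ofReal_toReal h3top).symm
  -- effective speed `U = N/L`; then `2BTU = N/(Kr+1)` and the radius is `UT`
  set U : ℝ := N / (2 * B * (Kr + 1) * T) with hU
  have hU0 : 0 ≤ U := by positivity
  have hLU : 2 * B * (Kr + 1) * T * U = N := by
    rw [hU]; field_simp
  have h2BTU : 2 * B * T * U = N / (Kr + 1) := by
    rw [hU]; field_simp
  refine ⟨U, hU0, by rw [hNeq, hLU], ?_⟩
  have h1 : U ^ (2 * (1 : ℝ) - 1) = U := by norm_num
  have h2 : (T - t) ^ (1 : ℝ) = T - t := Real.rpow_one _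
  rcases hN0.eq_or_lt with hN00 | hNpos
  · -- `N = 0`: `U = 0`, centre and radius `0`
    have hU00 : U = 0 := by rw [hU, ← hN00, zero_div]
    refine ⟨0, 0, ?_, ?_⟩
    · rw [h1, h2, hU00]; simp
    · rw [hU00]; simp
  · -- `N > 0`: a point with `|u(t,x₀)| ≥ 2BTU`, the ball `B(x₀, UT)`
    have ha : 2 * B * T * U * Kr < N := by
      rw [h2BTU, div_mul_eq_mul_div, div_lt_iff₀ hK1]
      nlinarith
    obtain ⟨x₀, hx₀⟩ : ∃ x, 2 * B * T * U ≤ ‖u t x‖ := exists_le_norm_of_l3 hKr0 hE ha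
    have hUT0 : 0 ≤ U * T := by positivity
    refine ⟨x₀, U * T, ?_, ?_⟩
    · -- scale clause `1 · U · (T - t) ≤ U T`
      rw [h1, h2, one_mul]
      exact mul_le_mul_of_nonneg_left hTt hU0
    · -- mass clause: `|u(t,·)| ≥ BTU` on the ball, `vol = (4π/3)(UT)³`
      have hlow : ∀ x ∈ ball x₀ (U * T), ENNReal.ofReal ((B * T * U) ^ 2) ≤ ‖u t x‖ₑ ^ 2 := by
        intro x hx
        have hdist : ‖x₀ - x‖ < U * T := by
          rw [mem_ball, dist_eq_norm] at hx; rwa [norm_sub_rev]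
        have hl1 : ‖u t x₀‖ ≤ ‖u t x‖ + ‖u t x₀ - u t x‖ := norm_le_insert' _ _
        have hl2 : ‖u t x₀ - u t x‖ ≤ B * ‖x₀ - x‖ := (hbd t ht').2 x₀ x
        have hl3 : B * ‖x₀ - x‖ ≤ B * (U * T) := mul_le_mul_of_nonneg_left hdist.le hB.le
        have hge : B * T * U ≤ ‖u t x‖ := by nlinarith
        have hge0 : 0 ≤ B * T * U := by positivity
        calc ENNReal.ofReal ((B * T * U) ^ 2) = ENNReal.ofReal (B * T * U) ^ 2 := by
              rw [ENNReal.ofReal_pow hge0]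
          _ ≤ ‖u t x‖ₑ ^ 2 := by
              gcongr
              rw [← ofReal_norm]
              exact ENNReal.ofReal_le_ofReal hge
      calc ENNReal.ofReal (Real.pi * 4 / 3 * B ^ 2 * T ^ 2 * (U ^ 2 * (U * T) ^ 3))
          = ENNReal.ofReal ((B * T * U) ^ 2) * volume (ball x₀ (U * T)) := by
            rw [EuclideanSpace.volume_ball_fin_three, ← ENNReal.ofReal_pow hUT0,
              ← ENNReal.ofReal_mul (pow_nonneg hUT0 3),
              ← ENNReal.ofReal_mul (pow_nonneg (by positivity : (0 : ℝ) ≤ B * T * U) 2)]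
            congr 1
            ring
        _ = ∫⁻ _ in ball x₀ (U * T), ENNReal.ofReal ((B * T * U) ^ 2) := (setLIntegral_const _ _).symm
        _ ≤ ∫⁻ x in ball x₀ (U * T), ‖u t x‖ₑ ^ 2 :=
            lintegral_mono_ae ((ae_restrict_mem measurableSet_ball).mono hlow)

/-! ## §4  Consequences: the node and the crux live on the blow-up branch only; ONE-STUB composition -/

/-- **`K₃(1)` over the whole frame ⟺ `K₃(1)` on the blow-up branch.** -/
theorem effScaleSaturation_one_iff_blowupBranch : EffScaleSaturation 1 ↔ EffScaleSaturationB 1 := by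
  constructor
  · exact fun h ν T hν hT u p hcl hLH hdec _ => h ν T hν hT u p hcl hLH hdec
  · intro h ν T hν hT u p hcl hLH hdec
    by_cases hext : HasSmoothExtensionPast ν 0 u T
    · exact effSaturatesAt_one_of_hasSmoothExtensionPast hν hT hLH hdec hext
    · exact h ν T hν hT u p hcl hLH hdec hext

/-- `EffScaleSaturationB 1` ⟺ the verbatim stub statement `EffSatBlowup` (bookkeeping `U^{2·1-1}(T-t)^1`). -/
theorem effScaleSaturationB_one_iff_stub : EffScaleSaturationB 1 ↔ EffSatBlowup := by
  constructor
  · intro h ν T hν hT u p hcl hLH hdec hext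
    obtain ⟨m, hm, R₀, hR₀, L, hL, T₁, hT₁, hwin⟩ := h ν T hν hT u p hcl hLH hdec hext
    refine ⟨m, hm, R₀, hR₀, L, hL, T₁, hT₁, fun t ht => ?_⟩
    obtain ⟨U, hU0, hU3, x₀, r, hr, hloc⟩ := hwin t ht
    refine ⟨U, hU0, hU3, x₀, r, ?_, hloc⟩
    have h1 : U ^ (2 * (1 : ℝ) - 1) = U := by norm_num
    have h2 : (T - t) ^ (1 : ℝ) = T - t := Real.rpow_one _
    rw [h1, h2] at hr
    exact hr
  · intro h ν T hν hT u p hcl hLH hdec hext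
    obtain ⟨m, hm, R₀, hR₀, L, hL, T₁, hT₁, hwin⟩ := h ν T hν hT u p hcl hLH hdec hext
    refine ⟨m, hm, R₀, hR₀, L, hL, T₁, hT₁, fun t ht => ?_⟩
    obtain ⟨U, hU0, hU3, x₀, r, hr, hloc⟩ := hwin t ht
    refine ⟨U, hU0, hU3, x₀, r, ?_, hloc⟩
    have h1 : U ^ (2 * (1 : ℝ) - 1) = U := by norm_num
    have h2 : (T - t) ^ (1 : ℝ) = T - t := Real.rpow_one _
    rw [h1, h2]
    exact hr

/-- **The crux `L3CascadeJaw` (route decl, BY NAME) ⟺ its blow-up-branch half.** -/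
theorem l3CascadeJaw_iff_blowupBranch :
    Summit.NavierStokesRegularity.NavierStokesRegularity.Theses.L3TimeExponentPincer.L3CascadeJaw ↔
      JawBlowupBranch := by
  constructor
  · exact fun h q hq4 hq5 ν T hν hT u p hcl hLH hdec _ => h q hq4 hq5 ν T hν hT u p hcl hLH hdec
  · intro h q hq4 hq5 ν T hν hT u p hcl hLH hdec
    by_cases hext : HasSmoothExtensionPast ν 0 u T
    · exact jawSmoothBranch_holds q hq4 hq5 ν T hν hT u p hcl hLH hdec hext
    · exact h q hq4 hq5 ν T hν hT u p hcl hLH hdec hext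

/-- **ONE-STUB COMPOSITION.**  The single open stub `stub_effSaturation_blowup` (= `EffSatBlowup`) implies the
crux `L3CascadeJaw` BY NAME: line `EffSat`'s entire open content is `K₃(1)` on the blow-up branch. -/
theorem l3CascadeJaw_of_effSatBlowup (h : EffSatBlowup) :
    Summit.NavierStokesRegularity.NavierStokesRegularity.Theses.L3TimeExponentPincer.L3CascadeJaw := by
  rw [l3CascadeJaw_iff_blowupBranch]
  intro q hq4 hq5 ν T hν hT u p hcl hLH hdec hext
  have hK : EffSaturatesAt 1 u T :=
    (effScaleSaturationB_one_iff_stub.2 h) ν T hν hT u p hcl hLH hdec hext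
  exact jaw_of_effSaturatesAt (σ := 1) (by norm_num) hν hT hLH hK (by linarith)
    (by rw [qOfSigma_one]; exact hq5)

/-- … and `K₃(1)` over the WHOLE frame follows from the blow-up stub alone. -/
theorem effScaleSaturation_one_of_effSatBlowup (h : EffSatBlowup) : EffScaleSaturation 1 :=
  effScaleSaturation_one_iff_blowupBranch.2 (effScaleSaturationB_one_iff_stub.2 h)

end Summit.NavierStokesRegularity.NavierStokesRegularity.Theorems.L3TimeExponentPincerSmoothBranch

end
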